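/-
Copyright (c) 2026. All rights reserved.
Released under Apache 2.0 license as described in the file LICENSE.
Authors: abc-iut cell, wave-2 seat abc-iut-L3-t11 (gen 2; row (β)-3: compatible vertex/branch systems along the
finite Galois levels of a tower — points in orbits, double-coset representatives, uniform representatives).
-/
import Literature.AnabelianGeometry.SemiGraphs.GaloisLevelDescent
import Literature.AnabelianGeometry.SemiGraphs.TemperedBranchPairProducer
import HarnessLib

/-!
# [SemiAnbd] Thm 3.7 (iii), Comments (6)(b): compatible branch systems along a Galois tower

Mochizuki, *Semi-graphs of anabelioids*, Publ. RIMS **42** (2006) [MochizukiSemiAnbd2006], proof of Thm. 3.7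
(iii) p. 41 with the author's *Comments* (2020), (6)(b) ("the subjoints `(f_i, f'_i)` … converge, in the profinite
topology, to some profinite subjoint … [cf. Remark 2.2.1]"), Definition 2.2 (i) p. 23 (branches ↔ double cosets)
and Remark 2.2.1 p. 24.

PROOF-ONLY toolkit over `GaloisCoveringTorsor.lean` / `GaloisLevelDescent.lean`, for Galois level data `D`
(abc-iut-L3-t9) with connected levels: for an `ℕ`-indexed compatible system of vertex-orbits `W n` of the
levels `𝔾_{S n}` over a vertex `v`,
* `exists_ptSeq`: compatible base POINTS `p n ∈ W n ⊆ (S n)_v` (abc-iut-L3-t9's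
  `CovObj.exists_mem_orbit_map_eq`: equivariant maps of transitive sets are onto);
* `CovObj.exists_brOf_ptHom`: a branch at the orbit of `x` over `b` is `brOf b (ψ_x(y) · x)`, `y ∈ Π_v`
  (Def. 2.2 (i): branches at a vertex over `b` ↔ `Ñ\Π_v/Π_b`);
* `mem_doubleCoset_of_branchMap_eq` (naturality, DN): along `S (n+1) → S n` the representatives satisfy
  `y_{n+1} ∈ K_n·y_n·Π_b`, `K_n = ker ψ_{p n}`; `exists_uniform_rep`: a uniform `y ∈ ⋂_n K_n·y_n·Π_b`
  (compactness of `Π_v`; the double cosets are clopen, decreasing, nonempty);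
* `map_ptHom_conj_eq_of_mem`, `brOf_ptHom_eq_of_mem`: the dictionary is constant on `K_n·y·Π_b`;
* `exists_edge_lift`: if `q n ∈ ψ_{p n}(y Π_b y⁻¹)` compatibly (`q n = levelDesc n (q (n+1))`), then one
  `z = y·b_*(e)·y⁻¹` has `ψ_{p n}(z) = q n` for all `n` (compactness of `Π_e`).
Nothing here takes a side on [IUTchIII] Cor. 3.12.
-/

namespace Literature.AnabelianGeometry.SemiGraphs

namespace ProfiniteSemiGraph

open CategoryTheory Topology
open scoped Pointwise
open Literature.AlgebraicGeometry.Frobenioids.QuasiTemperoid.BTempConnected (ρ_one_apply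
  ρ_mul_apply ρ_inv_apply ρ_apply_inv)

universe u

variable {𝒢 : ProfiniteSemiGraph.{u}}

/-! ### One level: representatives over a vertex, branches at an orbit, stabilisers at the base point -/

section OneLevel

variable (S : CovObj 𝒢)
  (hconn : ∀ p q : S.Point, S.SameComponent p q)
  (htrans : ∀ (v : 𝒢.graph.Vertex) (x x' : (S.SV v).obj.V), ∃ σ : S ⟶ S, (σ.fV v).hom.hom x = x')

/-- A vertex-orbit over `v` has a representative in `S_v`. [cite: MochizukiSemiAnbd2006, Def. 2.2(i) p.23] -/
theorem CovObj.exists_rep_of_base_eq (V : S.OVertex) {v : 𝒢.graph.Vertex} (h : CovObj.OVertex.base S V = v) :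
    ∃ x : (S.SV v).obj.V, Quot.mk S.VRel ⟨v, x⟩ = V := by
  induction V using Quot.ind with
  | mk p =>
    obtain ⟨w, x⟩ := p
    change w = v at h
    subst h
    exact ⟨x, rfl⟩

include hconn htrans

/-- `q` fixes the vertex-orbit of the base point `x` iff `q ∈ ψ_x(Π_v)` (Remark 2.2.1, at the base point).
[cite: MochizukiSemiAnbd2006, Rmk. 2.2.1 p.24] -/
theorem CovObj.stab_mk_iff {v : 𝒢.graph.Vertex} (x : (S.SV v).obj.V) (q : Aut S) :
    CovObj.OVertex.map q.hom (Quot.mk S.VRel ⟨v, x⟩) = Quot.mk S.VRel ⟨v, x⟩ ↔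
      q ∈ (S.ptHom hconn htrans x).range := by
  have h := S.mk_aut_eq_mk_aut_iff hconn htrans x q 1
  rw [inv_one, one_mul] at h
  exact h

/-- **Branches at the orbit of the base point** (Def. 2.2 (i)): a branch over `b` abutting to the orbit of `x`
is `brOf b (ψ_x(y) · x)` for some `y ∈ Π_v`. [cite: MochizukiSemiAnbd2006, Def. 2.2(i) p.23] -/
theorem CovObj.exists_brOf_ptHom (b : 𝒢.graph.Branch) {v : 𝒢.graph.Vertex} (hb : 𝒢.graph.abuts b = some v)
    (x : (S.SV v).obj.V) (B : S.orbitGraph.Branch) (hBb : S.orbitGraphProj.branchMap B = b)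
    (hBW : S.orbitGraph.abuts B = some (Quot.mk S.VRel ⟨v, x⟩)) :
    ∃ y : 𝒢.Gv v, B = S.brOf b hb (((S.ptHom hconn htrans x y).hom.fV v).hom.hom x) := by
  obtain ⟨z, rfl⟩ := S.exists_eq_brOf b hb B hBb
  rw [S.abuts_brOf] at hBW
  obtain ⟨g, hg⟩ := S.exists_ρ_of_mk_eq_mk (Option.some.inj hBW).symm
  refine ⟨g⁻¹, ?_⟩
  rw [S.ptHom_inv_apply hconn htrans x g, hg]

/-- `q` fixes `brOf b (ψ_x(y) · x)` iff `q ∈ ψ_x(y Π_b y⁻¹)` (Remark 2.2.1 at the base point).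
[cite: MochizukiSemiAnbd2006, Rmk. 2.2.1 p.24] -/
theorem CovObj.stab_brOf_ptHom_iff {b : 𝒢.graph.Branch} {v : 𝒢.graph.Vertex} {hb : 𝒢.graph.abuts b = some v}
    (x : (S.SV v).obj.V) (q : Aut S) (y : 𝒢.Gv v) :
    (CovObj.orbitGraphMap q.hom).branchMap (S.brOf b hb (((S.ptHom hconn htrans x y).hom.fV v).hom.hom x)) =
        S.brOf b hb (((S.ptHom hconn htrans x y).hom.fV v).hom.hom x) ↔
      q ∈ ((𝒢.branchSubgroup b v hb).map (MulAut.conj y).toMonoidHom).map (S.ptHom hconn htrans x) := by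
  have h := S.stab_brOf_iff' hconn htrans x (b := b) (hb := hb) 1 q y
  rw [one_mul] at h
  rw [h]
  have h1 : (MulAut.conj (1 : Aut S)).toMonoidHom = MonoidHom.id _ := by
    ext a; simp
  rw [h1, Subgroup.map_id]

omit hconn htrans in
/-- Conjugating a subgroup by one of its elements does nothing. [folklore] -/
private theorem map_conj_eq_self_of_mem {G : Type u} [Group G] (B : Subgroup G) {p : G} (hp : p ∈ B) :
    B.map (MulAut.conj p).toMonoidHom = B := by
  ext x
  constructor
  · rintro ⟨q, hq, rfl⟩
    exact B.mul_mem (B.mul_mem hp hq) (B.inv_mem hp)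
  · intro hx
    exact ⟨p⁻¹ * x * p, B.mul_mem (B.mul_mem (B.inv_mem hp) hx) hp, by simp [mul_assoc]⟩

omit hconn htrans in
/-- `conj (a * c)` on subgroups is `conj a ∘ conj c`. [folklore] -/
private theorem map_conj_mul {G : Type u} [Group G] (B : Subgroup G) (a c : G) :
    B.map (MulAut.conj (a * c)).toMonoidHom = (B.map (MulAut.conj c).toMonoidHom).map (MulAut.conj a).toMonoidHom := by
  rw [Subgroup.map_map]
  congr 1
  ext x
  simp [mul_assoc]

omit hconn htrans in
/-- A homomorphism intertwines conjugations: `f (a K a⁻¹) = f(a) f(K) f(a)⁻¹`. [folklore] -/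
private theorem map_map_conj {G H : Type u} [Group G] [Group H] (f : G →* H) (K : Subgroup G) (a : G) :
    (K.map (MulAut.conj a).toMonoidHom).map f = (K.map f).map (MulAut.conj (f a)).toMonoidHom := by
  rw [Subgroup.map_map, Subgroup.map_map]
  congr 1
  ext x
  simp

/-- The dictionary is constant on double cosets `K·y·Π_b` (`K = ker ψ_x`): subgroup form.
[cite: MochizukiSemiAnbd2006, Rmk. 2.2.1 p.24] -/
theorem CovObj.map_ptHom_conj_eq_of_mem {b : 𝒢.graph.Branch} {v : 𝒢.graph.Vertex}
    {hb : 𝒢.graph.abuts b = some v} (x : (S.SV v).obj.V) {y y' : 𝒢.Gv v}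
    (hy : y' ∈ ((S.ptHom hconn htrans x).ker : Set (𝒢.Gv v)) * {y} * (𝒢.branchSubgroup b v hb : Set (𝒢.Gv v))) :
    ((𝒢.branchSubgroup b v hb).map (MulAut.conj y').toMonoidHom).map (S.ptHom hconn htrans x) =
      ((𝒢.branchSubgroup b v hb).map (MulAut.conj y).toMonoidHom).map (S.ptHom hconn htrans x) := by
  obtain ⟨m, hm, p, hp, rfl⟩ := mem_coe_mul_singleton_mul_coe.mp hy
  rw [MonoidHom.mem_ker] at hm
  rw [map_conj_mul, map_conj_mul, map_conj_eq_self_of_mem _ hp, map_map_conj (S.ptHom hconn htrans x) _ m, hm]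
  have h1 : (MulAut.conj (1 : Aut S)).toMonoidHom = MonoidHom.id _ := by
    ext a; simp
  rw [h1, Subgroup.map_id]

/-- The dictionary is constant on double cosets `K·y·Π_b`: branch form.
[cite: MochizukiSemiAnbd2006, Def. 2.2(i) p.23] -/
theorem CovObj.brOf_ptHom_eq_of_mem {b : 𝒢.graph.Branch} {v : 𝒢.graph.Vertex}
    {hb : 𝒢.graph.abuts b = some v} (x : (S.SV v).obj.V) {y y' : 𝒢.Gv v}
    (hy : y' ∈ ((S.ptHom hconn htrans x).ker : Set (𝒢.Gv v)) * {y} * (𝒢.branchSubgroup b v hb : Set (𝒢.Gv v))) :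
    S.brOf b hb (((S.ptHom hconn htrans x y').hom.fV v).hom.hom x) =
      S.brOf b hb (((S.ptHom hconn htrans x y).hom.fV v).hom.hom x) := by
  obtain ⟨m, hm, p, hp, rfl⟩ := mem_coe_mul_singleton_mul_coe.mp hy
  rw [MonoidHom.mem_ker] at hm
  rw [S.brOf_aut_eq_iff hconn htrans x]
  refine ⟨p⁻¹, (𝒢.branchSubgroup b v hb).inv_mem hp, ?_⟩
  simp only [map_mul, map_inv, hm, one_mul, mul_inv_rev, mul_assoc, inv_mul_cancel, mul_one]

end OneLevel

/-! ### Along the tower -/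

namespace GaloisLevelData

variable (D : GaloisLevelData 𝒢) (h𝒢 : 𝒢.IsCountable)
  (hconn : ∀ (n : ℕ) (p q : (D.S n).Point), (D.S n).SameComponent p q)

/-- **Compatible base points inside a compatible system of vertex-orbits**: for orbits `W n` of
`(S n)_v` with `𝔾(g n)(W (n+1)) = W n` there are points `p n ∈ W n` with `g n (p (n+1)) = p n`.
[cite: MochizukiSemiAnbd2006, Thm 3.7(iii) p.41] -/
theorem exists_ptSeq {v : 𝒢.graph.Vertex} (W : ∀ n, (D.S n).OVertex)
    (hWv : ∀ n, CovObj.OVertex.base _ (W n) = v)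
    (hW : ∀ n, CovObj.OVertex.map (D.g n) (W (n + 1)) = W n) :
    ∃ p : ∀ n, ((D.S n).SV v).obj.V,
      (∀ n, Quot.mk (D.S n).VRel ⟨v, p n⟩ = W n) ∧ ∀ n, ((D.g n).fV v).hom.hom (p (n + 1)) = p n := by
  obtain ⟨x₀, hx₀⟩ := (D.S 0).exists_rep_of_base_eq (W 0) (hWv 0)
  -- the recursion on the subtype of points of `W n`
  let P : ∀ n, Type u := fun n => {x : ((D.S n).SV v).obj.V // Quot.mk (D.S n).VRel ⟨v, x⟩ = W n}
  have step : ∀ n (a : P n), ∃ a' : P (n + 1), ((D.g n).fV v).hom.hom a'.1 = a.1 := by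
    intro n a
    obtain ⟨y₀, hy₀⟩ := (D.S (n + 1)).exists_rep_of_base_eq (W (n + 1)) (hWv (n + 1))
    have h1 : (Quot.mk _ ⟨v, a.1⟩ : (D.S n).OVertex) = Quot.mk _ ⟨v, ((D.g n).fV v).hom.hom y₀⟩ := by
      rw [a.2, ← hW n, ← hy₀]; rfl
    obtain ⟨y, hy, hyx⟩ := CovObj.exists_mem_orbit_map_eq (D.g n) y₀ a.1 h1
    exact ⟨⟨y, hy.trans hy₀⟩, hyx⟩
  let f : ∀ n, P n := fun n => Nat.rec (motive := P) ⟨x₀, hx₀⟩ (fun k a => (step k a).choose) n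
  refine ⟨fun n => (f n).1, fun n => (f n).2, fun n => ?_⟩
  exact (step n (f n)).choose_spec

include hconn in
/-- The base-point stabilisers `K_n = ker ψ_{p n}` decrease along compatible base points.
[cite: MochizukiSemiAnbd2006, Thm 3.7(iii) p.41] -/
theorem ker_ptHom_anti {v : 𝒢.graph.Vertex} (p : ∀ n, ((D.S n).SV v).obj.V)
    (hp : ∀ n, ((D.g n).fV v).hom.hom (p (n + 1)) = p n) (n : ℕ) :
    ((D.S (n + 1)).ptHom (hconn (n + 1)) (D.htrans (n + 1)) (p (n + 1))).ker ≤
      ((D.S n).ptHom (hconn n) (D.htrans n) (p n)).ker := by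
  intro h hh
  rw [MonoidHom.mem_ker, CovObj.ptHom_eq_one_iff] at hh ⊢
  rw [← hp n, ← CovHom.fV_ρ, hh]

include hconn in
/-- `K_n ≤ K_m` for `m ≤ n`. [cite: MochizukiSemiAnbd2006, Thm 3.7(iii) p.41] -/
theorem ker_ptHom_anti' {v : 𝒢.graph.Vertex} (p : ∀ n, ((D.S n).SV v).obj.V)
    (hp : ∀ n, ((D.g n).fV v).hom.hom (p (n + 1)) = p n) {m n : ℕ} (h : m ≤ n) :
    ((D.S n).ptHom (hconn n) (D.htrans n) (p n)).ker ≤ ((D.S m).ptHom (hconn m) (D.htrans m) (p m)).ker := by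
  induction n, h using Nat.le_induction with
  | base => exact le_rfl
  | succ k _ ih => exact (D.ker_ptHom_anti hconn p hp k).trans ih

include hconn in
/-- **Naturality of the branch dictionary (DN)**: if the branch `brOf b (ψ(y') · p (n+1))` of level `n+1` maps
to `brOf b (ψ(y) · p n)` of level `n`, then `y' ∈ K_n · y · Π_b`. [cite: MochizukiSemiAnbd2006, Def. 2.2(i) p.23] -/
theorem mem_doubleCoset_of_branchMap_eq {v : 𝒢.graph.Vertex} (p : ∀ n, ((D.S n).SV v).obj.V)
    (hp : ∀ n, ((D.g n).fV v).hom.hom (p (n + 1)) = p n) {b : 𝒢.graph.Branch}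
    (hb : 𝒢.graph.abuts b = some v) (n : ℕ) (y y' : 𝒢.Gv v)
    (h : (CovObj.orbitGraphMap (D.g n)).branchMap
        ((D.S (n + 1)).brOf b hb ((((D.S (n + 1)).ptHom (hconn (n + 1)) (D.htrans (n + 1)) (p (n + 1)) y').hom.fV
          v).hom.hom (p (n + 1)))) =
      (D.S n).brOf b hb ((((D.S n).ptHom (hconn n) (D.htrans n) (p n) y).hom.fV v).hom.hom (p n))) :
    y' ∈ (((D.S n).ptHom (hconn n) (D.htrans n) (p n)).ker : Set (𝒢.Gv v)) * {y} *
      (𝒢.branchSubgroup b v hb : Set (𝒢.Gv v)) := by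
  rw [CovObj.branchMap_orbitGraphMap_brOf, D.fV_g_aut_apply hconn n, hp n,
    D.levelDesc_ptHom hconn n (p (n + 1)) (p n) (hp n), (D.S n).brOf_aut_eq_iff (hconn n) (D.htrans n) (p n)]
    at h
  obtain ⟨k, hk, hk'⟩ := h
  -- `ψ(k) = ψ(y')⁻¹ ψ(y)` ⇒ `y'⁻¹ y k⁻¹ ∈ K_n`
  have hm : y'⁻¹ * y * k⁻¹ ∈ ((D.S n).ptHom (hconn n) (D.htrans n) (p n)).ker := by
    rw [MonoidHom.mem_ker, map_mul, map_mul, map_inv, map_inv, hk', mul_inv_cancel]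
  exact mem_coe_mul_singleton_mul_coe.mpr ⟨(y * k⁻¹) * (y'⁻¹ * y * k⁻¹)⁻¹ * (y * k⁻¹)⁻¹,
    (MonoidHom.normal_ker _).conj_mem _ (((D.S n).ptHom (hconn n) (D.htrans n) (p n)).ker.inv_mem hm) (y * k⁻¹),
    k⁻¹, (𝒢.branchSubgroup b v hb).inv_mem hk, by group⟩

include hconn in
/-- **A uniform representative** (Comments (6)(b) "converge in the profinite topology"): if
`y (n+1) ∈ K_n · y n · Π_b` for all `n`, some `y ∈ Π_v` lies in every `K_n · y n · Π_b` (the double cosets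
are clopen, nonempty and decreasing; `Π_v` is compact). [cite: MochizukiSemiAnbd2006, Thm 3.7(iii) p.41] -/
theorem exists_uniform_rep {v : 𝒢.graph.Vertex} (p : ∀ n, ((D.S n).SV v).obj.V)
    (hp : ∀ n, ((D.g n).fV v).hom.hom (p (n + 1)) = p n) {b : 𝒢.graph.Branch}
    (hb : 𝒢.graph.abuts b = some v) (ys : ℕ → 𝒢.Gv v)
    (hys : ∀ n, ys (n + 1) ∈ (((D.S n).ptHom (hconn n) (D.htrans n) (p n)).ker : Set (𝒢.Gv v)) * {ys n} *
      (𝒢.branchSubgroup b v hb : Set (𝒢.Gv v))) :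
    ∃ y : 𝒢.Gv v, ∀ n, y ∈ (((D.S n).ptHom (hconn n) (D.htrans n) (p n)).ker : Set (𝒢.Gv v)) * {ys n} *
      (𝒢.branchSubgroup b v hb : Set (𝒢.Gv v)) := by
  let K : ℕ → Subgroup (𝒢.Gv v) := fun n => ((D.S n).ptHom (hconn n) (D.htrans n) (p n)).ker
  let E : ℕ → Set (𝒢.Gv v) := fun n => (K n : Set (𝒢.Gv v)) * {ys n} * (𝒢.branchSubgroup b v hb : Set _)
  haveI : ∀ n, (K n).Normal := fun n => MonoidHom.normal_ker _
  have hEcl : ∀ n, IsClosed (E n) := fun n =>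
    (isClopen_coe_mul_singleton_mul_coe ((D.S n).isOpen_ker_ptHom (hconn n) (D.htrans n) (p n)) (ys n)).1
  have hEne : ∀ n, (E n).Nonempty := fun n =>
    ⟨ys n, mem_coe_mul_singleton_mul_coe.mpr ⟨1, (K n).one_mem, 1, Subgroup.one_mem _, by simp⟩⟩
  have hEanti : ∀ n, E (n + 1) ⊆ E n := by
    intro n z hz
    obtain ⟨m, hm, q, hq, rfl⟩ := mem_coe_mul_singleton_mul_coe.mp hz
    have hEE : (K n : Set (𝒢.Gv v)) * {ys (n + 1)} * (𝒢.branchSubgroup b v hb : Set _) = E n :=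
      coe_mul_singleton_mul_coe_eq_of_mem (hys n)
    rw [← hEE]
    exact mem_coe_mul_singleton_mul_coe.mpr ⟨m, D.ker_ptHom_anti hconn p hp n hm, q, hq, rfl⟩
  obtain ⟨y, hy⟩ := IsCompact.nonempty_iInter_of_sequence_nonempty_isCompact_isClosed E hEanti hEne
    (hEcl 0).isCompact hEcl
  exact ⟨y, fun n => Set.mem_iInter.mp hy n⟩

/-- Preimages of points under a map all of whose fibres are open are closed. [folklore] -/
private theorem isClosed_preimage_singleton_of_isOpen {X Y : Type*} [TopologicalSpace X] (f : X → Y)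
    (h : ∀ y, IsOpen (f ⁻¹' {y})) (y : Y) : IsClosed (f ⁻¹' {y}) := by
  refine ⟨?_⟩
  rw [← Set.preimage_compl]
  have : f ⁻¹' ({y}ᶜ) = ⋃ y' ∈ ({y}ᶜ : Set Y), f ⁻¹' {y'} := by
    ext x; simp
  rw [this]
  exact isOpen_biUnion fun y' _ => h y'

include hconn in
/-- **Lifting a compatible family through the dictionary** (the limit step of (I4′)): if `q n ∈ ψ_{p n}(y Π_b y⁻¹)`
for every `n`, compatibly with the finite-level descent (`q n = levelDesc n (q (n+1))`), then ONE element
`z = y·b_*(e)·y⁻¹` of `y Π_b y⁻¹` satisfies `ψ_{p n}(z) = q n` for all `n` (the sets of such `e ∈ Π_e` are closed,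
nonempty, decreasing; `Π_e` is compact). [cite: MochizukiSemiAnbd2006, Thm 3.7(iii) p.41] -/
theorem exists_edge_lift {v : 𝒢.graph.Vertex} (p : ∀ n, ((D.S n).SV v).obj.V)
    (hp : ∀ n, ((D.g n).fV v).hom.hom (p (n + 1)) = p n) {b : 𝒢.graph.Branch}
    (hb : 𝒢.graph.abuts b = some v) (y : 𝒢.Gv v) (q : ∀ n, Aut (D.S n))
    (hq : ∀ n, q n = D.levelDesc hconn n (q (n + 1)))
    (hmem : ∀ n, q n ∈ ((𝒢.branchSubgroup b v hb).map (MulAut.conj y).toMonoidHom).map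
      ((D.S n).ptHom (hconn n) (D.htrans n) (p n))) :
    ∃ e : 𝒢.Ge (𝒢.graph.edgeOf b), ∀ n,
      (D.S n).ptHom (hconn n) (D.htrans n) (p n) (y * 𝒢.brHom b v hb e * y⁻¹) = q n := by
  let F : ∀ n, 𝒢.Ge (𝒢.graph.edgeOf b) → Aut (D.S n) := fun n e =>
    (D.S n).ptHom (hconn n) (D.htrans n) (p n) (y * 𝒢.brHom b v hb e * y⁻¹)
  have hFopen : ∀ n (σ : Aut (D.S n)), IsOpen (F n ⁻¹' {σ}) := by
    intro n σ
    have : F n ⁻¹' {σ} = (fun e => y * 𝒢.brHom b v hb e * y⁻¹) ⁻¹'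
        ((D.S n).ptHom (hconn n) (D.htrans n) (p n) ⁻¹' {σ}) := rfl
    rw [this]
    exact ((D.S n).isOpen_ptHom_preimage (hconn n) (D.htrans n) (p n) σ).preimage
      ((continuous_const.mul (𝒢.brHom b v hb).continuous).mul continuous_const)
  let Z : ℕ → Set (𝒢.Ge (𝒢.graph.edgeOf b)) := fun n => F n ⁻¹' {q n}
  have hZcl : ∀ n, IsClosed (Z n) := fun n => isClosed_preimage_singleton_of_isOpen (F n) (hFopen n) (q n)
  have hZne : ∀ n, (Z n).Nonempty := by
    intro n
    obtain ⟨a, ⟨k, ⟨e, rfl⟩, rfl⟩, ha⟩ := hmem n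
    exact ⟨e, ha⟩
  have hZanti : ∀ n, Z (n + 1) ⊆ Z n := by
    intro n e he
    change F n e = q n
    change F (n + 1) e = q (n + 1) at he
    rw [hq n, ← he]
    exact (D.levelDesc_ptHom hconn n (p (n + 1)) (p n) (hp n) _).symm
  obtain ⟨e, he⟩ := IsCompact.nonempty_iInter_of_sequence_nonempty_isCompact_isClosed Z hZanti hZne
    (hZcl 0).isCompact hZcl
  exact ⟨e, fun n => Set.mem_iInter.mp he n⟩

end GaloisLevelData

end ProfiniteSemiGraph

end Literature.AnabelianGeometry.SemiGraphs
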